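import Literature.NumberTheory.LFunctions.Zhang2022.RepairSection10Theta
import Literature.NumberTheory.LFunctions.Zhang2022.RepairFormulaIGram

/-!
# The `J`-profile of a design: the tent `f_θ` on `[0,1]`, its `H¹` witness, and its tail functional

Trunk T-ANT (NumberTheory/LFunctions). Repair rung F-S1R (D-0077) for Y. Zhang, *Discrete mean estimates
and the Landau–Siegel zero*, arXiv:2211.02515v1 [Zhang2022LandauSiegel] — **an unrefereed manuscript under
adjudication; nothing here asserts any of its claims**. Structural route to the barrier-in-class theorem
(cell file `repair/p4/Q2-ARCHITECTURE.md`, lead ruling R3): every main-order constant of the §2 endgame is a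
value of the tree's Hermitian form `𝔅` (`MainTermFormPSD.mainTermForm`, polar form
`MainTermFormCauchySchwarz.mainTermFormPolar`) on two profiles on `[0,1]` — the glued mollifier profile `𝔤_θ`
and the test-polynomial profile `f_θ`. This file supplies the SECOND profile and everything the cross-term
dictionary (`𝔡′(θ) + 𝔡(θ) = P(𝔤_θ, f_θ)`, K-S3) needs about it:

* `tentT θ` — the tent `f̃` of (2.28) as a profile on `[0,1]` under the tie of record `J₁ = [ν₂, ν₁]`:
  `f_θ(z) = σ·max(0, h − |z − mid₁|)`, `σ = 2/(ν₁−ν₂)`, `h = (ν₁−ν₂)/2`, `mid₁ = (ν₁+ν₂)/2` (height `σh = 1`);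
  `tentT' θ` — its RIGHT derivative (`σ` on `[ν₂, mid₁)`, `−σ` on `[mid₁, ν₁)`, `0` elsewhere); the four
  piece formulas `tentT_of_le_lo`, `tentT_lower`, `tentT_upper`, `tentT_of_hi_le`.
* `hasDerivWithinAt_tentT` (right derivative at EVERY point, kinks included), `continuous_tentT`,
  `isH1_tentT : IsH1OnUnitInterval (tentT θ) (tentT' θ)` (`MainTermFormH1.isH1_of_hasDerivWithinAt_Ioi`) —
  hypothesis `hf` of the assembly `RepairBarrierAssembly.not_repairable_true_need_of_dictionary`.
* `kinkedProfile_tentT` (the tent is a `RepairFormulaIGram.KinkedProfile`);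
* the definite integrals of the tent: `integral_tentT_lower/upper`, `integral_tentT_tail_*` (`∫_y^1 f_θ` on
  each of the four regions: `h`, `h − σ(y−ν₂)²/2`, `σ(ν₁−y)²/2`, `0`), `integral_tentT_unit = h`.
* **the tail functional of the dipole rule** (pub-zhang `STRUCTURE.md` §2, formula I: the `n`-side of
  `Θ₁(𝐚₁, 𝐚₂)` sees a profile `v` through `v′ + iπS_j v + π²N_j∫_y^1 v`): for the tent this is EXACTLY
  Lemma 10.2 — `tentTail_lower : conj(f′ + iπS_jf + π²N_j∫_y^1 f)(y) = −σ(−1 + 𝔶𝔶₁ⱼ(y))` on `[ν₂, mid₁)`,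
  `tentTail_upper : … = −σ(1 + 𝔶𝔶₂ⱼ(y))` on `[mid₁, ν₁)`, `tentTail_below : … = π²N_j h` below the tent,
  `tentTail_above : … = 0` above it (`𝔶𝔶 = RepairSection10Theta.yy1T/yy2T`; the identity
  `(ν₁−y)² − 2(mid₁−y)² = 2h² − (y−ν₂)²` is why (10.9)'s polynomial has that shape); and the `m`-side
  `tentDipole_lower/upper : (f′ + iπjf)(y) = σ(1 + iπj(y−ν₂))`, `−σ(1 − iπj(ν₁−y))` (Lemma 10.1 (10.3)/(10.4)).

Domain: `ν₂ < ν₁` (non-degenerate tent); for the integrals over `[y,1]` also `ν₁ ≤ 1`. No statement about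
Theorems 1–2 of the manuscript; pure calculus on the transcribed objects.
-/

noncomputable section

open Complex Real ComplexConjugate MeasureTheory Set intervalIntegral

namespace Literature.NumberTheory.LFunctions.Zhang2022

namespace Repair

/-! ### The tent and its right derivative -/

/-- the tent of (2.28) as a REAL function under the tie `J₁ = [ν₂, ν₁]`: `σ·max(0, h − |z − mid₁|)`
(`= σ(z − ν₂)` on `[ν₂, mid₁]`, `σ(ν₁ − z)` on `[mid₁, ν₁]`, `0` elsewhere). [cite: Zhang2022LandauSiegel, (2.28) p.10] -/
def tentR (θ : Theta) (z : ℝ) : ℝ := θ.sig * max 0 (θ.hw - |z - θ.mid1|)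

/-- the tent profile `f_θ : [0,1] → ℂ` (real-valued). [cite: Zhang2022LandauSiegel, (2.28) p.10] -/
def tentT (θ : Theta) : ℝ → ℂ := fun z => ((tentR θ z : ℝ) : ℂ)

/-- the RIGHT derivative of the tent, as a real function: `σ` on `[ν₂, mid₁)`, `−σ` on `[mid₁, ν₁)`, `0` else.
[cite: Zhang2022LandauSiegel, (2.28) p.10] -/
def tentR' (θ : Theta) (z : ℝ) : ℝ :=
  if z < θ.nu2 then 0 else if z < θ.mid1 then θ.sig else if z < θ.nu1 then -θ.sig else 0

/-- the right derivative of the tent profile. [cite: Zhang2022LandauSiegel, (2.28) p.10] -/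
def tentT' (θ : Theta) : ℝ → ℂ := fun z => ((tentR' θ z : ℝ) : ℂ)

variable {θ : Theta}

/-- `mid₁ = ν₂ + h`. [cite: Zhang2022LandauSiegel, (2.28) p.10] -/
theorem Theta.mid1_eq (θ : Theta) : θ.mid1 = θ.nu2 + θ.hw := by unfold Theta.mid1 Theta.hw; ring
/-- `ν₁ = mid₁ + h`. [cite: Zhang2022LandauSiegel, (2.28) p.10] -/
theorem Theta.nu1_eq (θ : Theta) : θ.nu1 = θ.mid1 + θ.hw := by unfold Theta.mid1 Theta.hw; ring
/-- `h > 0` for a non-degenerate tent. [cite: Zhang2022LandauSiegel, (2.28) p.10] -/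
theorem Theta.hw_pos (h : θ.nu2 < θ.nu1) : 0 < θ.hw := by unfold Theta.hw; linarith
/-- `σ > 0` for a non-degenerate tent. [cite: Zhang2022LandauSiegel, (2.28) p.10] -/
theorem Theta.sig_pos (h : θ.nu2 < θ.nu1) : 0 < θ.sig := by
  unfold Theta.sig; exact div_pos two_pos (by linarith)
/-- `σ·h = 1` (the tent has height `1`). [cite: Zhang2022LandauSiegel, (2.28) p.10] -/
theorem Theta.sig_mul_hw (h : θ.nu2 < θ.nu1) : θ.sig * θ.hw = 1 := by
  have hne : θ.nu1 - θ.nu2 ≠ 0 := by linarith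
  unfold Theta.sig Theta.hw; field_simp
/-- `h = 1/σ`. [cite: Zhang2022LandauSiegel, (2.28) p.10] -/
theorem Theta.hw_eq_inv_sig (h : θ.nu2 < θ.nu1) : θ.hw = 1 / θ.sig := by
  rw [eq_div_iff (θ.sig_pos h).ne', mul_comm]; exact θ.sig_mul_hw h

/-- below the tent: `f_θ(z) = 0` for `z ≤ ν₂`. [cite: Zhang2022LandauSiegel, (2.28) p.10] -/
theorem tentR_of_le_lo (h : θ.nu2 < θ.nu1) {z : ℝ} (hz : z ≤ θ.nu2) : tentR θ z = 0 := by
  have hm := θ.mid1_eq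
  have : θ.hw - |z - θ.mid1| ≤ 0 := by
    rw [abs_of_nonpos (by linarith [θ.hw_pos h])]; linarith
  unfold tentR; rw [max_eq_left this, mul_zero]

/-- above the tent: `f_θ(z) = 0` for `ν₁ ≤ z`. [cite: Zhang2022LandauSiegel, (2.28) p.10] -/
theorem tentR_of_hi_le (h : θ.nu2 < θ.nu1) {z : ℝ} (hz : θ.nu1 ≤ z) : tentR θ z = 0 := by
  have hm := θ.nu1_eq
  have : θ.hw - |z - θ.mid1| ≤ 0 := by
    rw [abs_of_nonneg (by linarith [θ.hw_pos h])]; linarith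
  unfold tentR; rw [max_eq_left this, mul_zero]

/-- rising edge: `f_θ(z) = σ(z − ν₂)` for `ν₂ ≤ z ≤ mid₁`. [cite: Zhang2022LandauSiegel, (2.28) p.10] -/
theorem tentR_lower {z : ℝ} (h1 : θ.nu2 ≤ z) (h2 : z ≤ θ.mid1) : tentR θ z = θ.sig * (z - θ.nu2) := by
  have hm := θ.mid1_eq
  have : 0 ≤ θ.hw - |z - θ.mid1| := by rw [abs_of_nonpos (by linarith)]; linarith
  unfold tentR; rw [max_eq_right this, abs_of_nonpos (by linarith)]; rw [hm]; ring

/-- falling edge: `f_θ(z) = σ(ν₁ − z)` for `mid₁ ≤ z ≤ ν₁`. [cite: Zhang2022LandauSiegel, (2.28) p.10] -/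
theorem tentR_upper {z : ℝ} (h1 : θ.mid1 ≤ z) (h2 : z ≤ θ.nu1) : tentR θ z = θ.sig * (θ.nu1 - z) := by
  have hm := θ.nu1_eq
  have : 0 ≤ θ.hw - |z - θ.mid1| := by rw [abs_of_nonneg (by linarith)]; linarith
  unfold tentR; rw [max_eq_right this, abs_of_nonneg (by linarith)]; rw [hm]; ring

/-- `f_θ(z) = 0` for `z ≤ ν₂` (complex form). [cite: Zhang2022LandauSiegel, (2.28) p.10] -/
theorem tentT_of_le_lo (h : θ.nu2 < θ.nu1) {z : ℝ} (hz : z ≤ θ.nu2) : tentT θ z = 0 := by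
  simp [tentT, tentR_of_le_lo h hz]
/-- `f_θ(z) = 0` for `ν₁ ≤ z` (complex form). [cite: Zhang2022LandauSiegel, (2.28) p.10] -/
theorem tentT_of_hi_le (h : θ.nu2 < θ.nu1) {z : ℝ} (hz : θ.nu1 ≤ z) : tentT θ z = 0 := by
  simp [tentT, tentR_of_hi_le h hz]
/-- `f_θ(z) = σ(z − ν₂)` on the rising edge (complex form). [cite: Zhang2022LandauSiegel, (2.28) p.10] -/
theorem tentT_lower {z : ℝ} (h1 : θ.nu2 ≤ z) (h2 : z ≤ θ.mid1) :
    tentT θ z = ((θ.sig * (z - θ.nu2) : ℝ) : ℂ) := by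
  simp [tentT, tentR_lower h1 h2]
/-- `f_θ(z) = σ(ν₁ − z)` on the falling edge (complex form). [cite: Zhang2022LandauSiegel, (2.28) p.10] -/
theorem tentT_upper {z : ℝ} (h1 : θ.mid1 ≤ z) (h2 : z ≤ θ.nu1) :
    tentT θ z = ((θ.sig * (θ.nu1 - z) : ℝ) : ℂ) := by
  simp [tentT, tentR_upper h1 h2]
/-- `f_θ(ν₂) = f_θ(ν₁) = 0`, `f_θ(mid₁) = 1`. [cite: Zhang2022LandauSiegel, (2.28) p.10] -/
theorem tentT_nodes (h : θ.nu2 < θ.nu1) : tentT θ θ.nu2 = 0 ∧ tentT θ θ.nu1 = 0 ∧ tentT θ θ.mid1 = 1 := by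
  refine ⟨tentT_of_le_lo h le_rfl, tentT_of_hi_le h le_rfl, ?_⟩
  rw [tentT_lower (by rw [θ.mid1_eq]; linarith [θ.hw_pos h]) le_rfl, θ.mid1_eq]
  push_cast
  rw [show ((θ.sig : ℂ)) * ((θ.nu2 : ℂ) + θ.hw - θ.nu2) = ((θ.sig * θ.hw : ℝ) : ℂ) by push_cast; ring,
    θ.sig_mul_hw h]
  simp

/-- values of the right derivative: `0` for `z < ν₂`. [cite: Zhang2022LandauSiegel, (2.28) p.10] -/
theorem tentT'_of_lt_lo {z : ℝ} (hz : z < θ.nu2) : tentT' θ z = 0 := by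
  simp [tentT', tentR', hz]
/-- `σ` on `[ν₂, mid₁)`. [cite: Zhang2022LandauSiegel, (2.28) p.10] -/
theorem tentT'_lower {z : ℝ} (h1 : θ.nu2 ≤ z) (h2 : z < θ.mid1) : tentT' θ z = (θ.sig : ℂ) := by
  simp [tentT', tentR', not_lt.2 h1, h2]
/-- `−σ` on `[mid₁, ν₁)`. [cite: Zhang2022LandauSiegel, (2.28) p.10] -/
theorem tentT'_upper (h : θ.nu2 < θ.nu1) {z : ℝ} (h1 : θ.mid1 ≤ z) (h2 : z < θ.nu1) :
    tentT' θ z = -(θ.sig : ℂ) := by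
  have hm := θ.mid1_eq; have hp := θ.hw_pos h
  have h0 : ¬ z < θ.nu2 := not_lt.2 (by linarith)
  simp [tentT', tentR', h0, not_lt.2 h1, h2]
/-- `0` for `ν₁ ≤ z`. [cite: Zhang2022LandauSiegel, (2.28) p.10] -/
theorem tentT'_of_hi_le (h : θ.nu2 < θ.nu1) {z : ℝ} (hz : θ.nu1 ≤ z) : tentT' θ z = 0 := by
  have hm := θ.mid1_eq; have hn := θ.nu1_eq; have hp := θ.hw_pos h
  simp [tentT', tentR', not_lt.2 hz, not_lt.2 (show θ.mid1 ≤ z by linarith),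
    not_lt.2 (show θ.nu2 ≤ z by linarith)]

/-! ### Continuity, right derivatives, `H¹` -/

/-- the tent is continuous. [cite: Zhang2022LandauSiegel, (2.28) p.10] -/
theorem continuous_tentT (θ : Theta) : Continuous (tentT θ) := by
  unfold tentT tentR; fun_prop

/-- the right derivative of the tent exists at every point and is `tentT' θ`.
[cite: Zhang2022LandauSiegel, (2.28) p.10] -/
theorem hasDerivWithinAt_tentT (h : θ.nu2 < θ.nu1) (x : ℝ) :
    HasDerivWithinAt (tentT θ) (tentT' θ x) (Ioi x) x := by
  have hm := θ.mid1_eq; have hn := θ.nu1_eq; have hp := θ.hw_pos h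
  rcases lt_or_ge x θ.nu2 with hx | hx
  · -- below the tent: locally zero
    rw [tentT'_of_lt_lo hx]
    refine (hasDerivWithinAt_const x (Ioi x) (0:ℂ)).congr_of_eventuallyEq ?_ (tentT_of_le_lo h hx.le)
    filter_upwards [mem_nhdsWithin_of_mem_nhds (Iio_mem_nhds hx)] with z hz
    exact tentT_of_le_lo h (le_of_lt hz)
  rcases lt_or_ge x θ.mid1 with hx2 | hx2
  · -- rising edge
    rw [tentT'_lower hx hx2]
    have ha : HasDerivAt (fun z : ℝ => ((θ.sig * (z - θ.nu2) : ℝ) : ℂ)) (θ.sig : ℂ) x := by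
      have h1 : HasDerivAt (fun z : ℝ => θ.sig * (z - θ.nu2)) (θ.sig * 1) x :=
        ((hasDerivAt_id x).sub_const θ.nu2).const_mul θ.sig
      rw [mul_one] at h1
      simpa using h1.ofReal_comp
    refine ha.hasDerivWithinAt.congr_of_eventuallyEq ?_ (tentT_lower hx hx2.le)
    filter_upwards [mem_nhdsWithin_of_mem_nhds (Iio_mem_nhds hx2), self_mem_nhdsWithin] with z hz hz'
    exact tentT_lower (hx.trans (le_of_lt hz')) (le_of_lt hz)
  rcases lt_or_ge x θ.nu1 with hx3 | hx3
  · -- falling edge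
    rw [tentT'_upper h hx2 hx3]
    have ha : HasDerivAt (fun z : ℝ => ((θ.sig * (θ.nu1 - z) : ℝ) : ℂ)) (-(θ.sig : ℂ)) x := by
      have h1 : HasDerivAt (fun z : ℝ => θ.sig * (θ.nu1 - z)) (θ.sig * (-1)) x :=
        ((hasDerivAt_id x).const_sub θ.nu1).const_mul θ.sig
      rw [mul_neg_one] at h1
      simpa using h1.ofReal_comp
    refine ha.hasDerivWithinAt.congr_of_eventuallyEq ?_ (tentT_upper hx2 hx3.le)
    filter_upwards [mem_nhdsWithin_of_mem_nhds (Iio_mem_nhds hx3), self_mem_nhdsWithin] with z hz hz'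
    exact tentT_upper (hx2.trans (le_of_lt hz')) (le_of_lt hz)
  · -- above the tent: locally zero
    rw [tentT'_of_hi_le h hx3]
    refine (hasDerivWithinAt_const x (Ioi x) (0:ℂ)).congr_of_eventuallyEq ?_ (tentT_of_hi_le h hx3)
    filter_upwards [self_mem_nhdsWithin] with z hz
    exact tentT_of_hi_le h (hx3.trans (le_of_lt hz))

/-- the right derivative is measurable. [cite: Zhang2022LandauSiegel, (2.28) p.10] -/
theorem measurable_tentT' (θ : Theta) : Measurable (tentT' θ) := by
  unfold tentT' tentR'
  refine Complex.measurable_ofReal.comp ?_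
  refine Measurable.ite (measurableSet_lt measurable_id measurable_const) measurable_const ?_
  refine Measurable.ite (measurableSet_lt measurable_id measurable_const) measurable_const ?_
  exact Measurable.ite (measurableSet_lt measurable_id measurable_const) measurable_const measurable_const

/-- the right derivative is bounded by `σ`. [cite: Zhang2022LandauSiegel, (2.28) p.10] -/
theorem norm_tentT'_le (h : θ.nu2 < θ.nu1) (z : ℝ) : ‖tentT' θ z‖ ≤ θ.sig := by
  have hs := (θ.sig_pos h).le
  unfold tentT' tentR'
  split_ifs <;> simp [Complex.norm_real, abs_of_nonneg hs, hs]

/-- `f′_θ ∈ L²(0,1)` (bounded by `σ`). [cite: Zhang2022LandauSiegel, (2.28) p.10] -/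
theorem memLp_tentT' (h : θ.nu2 < θ.nu1) : MemLp (tentT' θ) 2 (volume.restrict (Ioc (0:ℝ) 1)) :=
  MemLp.of_bound (measurable_tentT' θ).aestronglyMeasurable θ.sig
    ((ae_restrict_iff' measurableSet_Ioc).2 (ae_of_all _ fun z _ => norm_tentT'_le h z))

/-- **the tent is a one-sided kinked profile** in the sense of `RepairFormulaIGram.KinkedProfile`
(continuous, right-differentiable, `f′ ∈ L²`). [cite: Zhang2022LandauSiegel, (2.28) p.10] -/
theorem kinkedProfile_tentT (h : θ.nu2 < θ.nu1) : KinkedProfile (tentT θ) (tentT' θ) where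
  cont := (continuous_tentT θ).continuousOn
  hasDeriv := fun x _ => hasDerivWithinAt_tentT h x
  memLp := memLp_tentT' h

/-- **the tent is an `H¹` profile on `[0,1]`** with derivative `tentT' θ` (hypothesis `hf` of the structural
assembly `RepairBarrierAssembly.not_repairable_true_need_of_dictionary`). [cite: Zhang2022LandauSiegel, (2.28) p.10] -/
theorem isH1_tentT (h : θ.nu2 < θ.nu1) : IsH1OnUnitInterval (tentT θ) (tentT' θ) :=
  (kinkedProfile_tentT h).isH1

/-! ### Integrals of the tent -/

/-- the tent is interval-integrable. [cite: Zhang2022LandauSiegel, (2.28) p.10] -/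
theorem intervalIntegrable_tentT (θ : Theta) (a b : ℝ) : IntervalIntegrable (tentT θ) volume a b :=
  (continuous_tentT θ).intervalIntegrable a b

/-- `∫_a^b f_θ = 0` below the tent. [cite: Zhang2022LandauSiegel, (2.28) p.10] -/
theorem integral_tentT_of_le_lo (h : θ.nu2 < θ.nu1) {a b : ℝ} (ha : a ≤ θ.nu2) (hb : b ≤ θ.nu2) :
    ∫ t in a..b, tentT θ t = 0 := by
  rw [intervalIntegral.integral_congr (g := fun _ => (0:ℂ)) (fun t ht => ?_), intervalIntegral.integral_zero]
  have : t ≤ θ.nu2 := by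
    rcases le_total a b with hab | hab
    · rw [uIcc_of_le hab] at ht; exact ht.2.trans hb
    · rw [uIcc_of_ge hab] at ht; exact ht.2.trans ha
  exact tentT_of_le_lo h this

/-- `∫_a^b f_θ = 0` above the tent. [cite: Zhang2022LandauSiegel, (2.28) p.10] -/
theorem integral_tentT_of_hi_le (h : θ.nu2 < θ.nu1) {a b : ℝ} (ha : θ.nu1 ≤ a) (hb : θ.nu1 ≤ b) :
    ∫ t in a..b, tentT θ t = 0 := by
  rw [intervalIntegral.integral_congr (g := fun _ => (0:ℂ)) (fun t ht => ?_), intervalIntegral.integral_zero]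
  have : θ.nu1 ≤ t := by
    rcases le_total a b with hab | hab
    · rw [uIcc_of_le hab] at ht; exact ha.trans ht.1
    · rw [uIcc_of_ge hab] at ht; exact hb.trans ht.1
  exact tentT_of_hi_le h this

/-- `∫_a^b f_θ` on the rising edge: `σ((b−ν₂)² − (a−ν₂)²)/2`. [cite: Zhang2022LandauSiegel, (2.28) p.10] -/
theorem integral_tentT_lower {a b : ℝ} (ha : θ.nu2 ≤ a) (ha' : a ≤ θ.mid1) (hb : θ.nu2 ≤ b)
    (hb' : b ≤ θ.mid1) :
    ∫ t in a..b, tentT θ t = ((θ.sig * ((b - θ.nu2) ^ 2 - (a - θ.nu2) ^ 2) / 2 : ℝ) : ℂ) := by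
  have hF : ∀ x ∈ uIcc a b, HasDerivAt (fun z : ℝ => ((θ.sig * (z - θ.nu2) ^ 2 / 2 : ℝ) : ℂ))
      (((θ.sig * (x - θ.nu2) : ℝ) : ℂ)) x := by
    intro x _
    have h1 : HasDerivAt (fun z : ℝ => θ.sig * (z - θ.nu2) ^ 2 / 2) (θ.sig * (x - θ.nu2)) x := by
      have := ((((hasDerivAt_id x).sub_const θ.nu2).pow 2).const_mul θ.sig).div_const 2
      exact this.congr_deriv (by norm_num [id]; try ring)
    simpa using h1.ofReal_comp
  rw [intervalIntegral.integral_congr (g := fun z => ((θ.sig * (z - θ.nu2) : ℝ) : ℂ)) (fun t ht => ?_),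
    intervalIntegral.integral_eq_sub_of_hasDerivAt hF (Continuous.intervalIntegrable (by fun_prop) _ _)]
  · push_cast; ring
  · rcases le_total a b with hab | hab
    · rw [uIcc_of_le hab] at ht; exact tentT_lower (ha.trans ht.1) (ht.2.trans hb')
    · rw [uIcc_of_ge hab] at ht; exact tentT_lower (hb.trans ht.1) (ht.2.trans ha')

/-- `∫_a^b f_θ` on the falling edge: `σ((ν₁−a)² − (ν₁−b)²)/2`. [cite: Zhang2022LandauSiegel, (2.28) p.10] -/
theorem integral_tentT_upper {a b : ℝ} (ha : θ.mid1 ≤ a) (ha' : a ≤ θ.nu1) (hb : θ.mid1 ≤ b)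
    (hb' : b ≤ θ.nu1) :
    ∫ t in a..b, tentT θ t = ((θ.sig * ((θ.nu1 - a) ^ 2 - (θ.nu1 - b) ^ 2) / 2 : ℝ) : ℂ) := by
  have hF : ∀ x ∈ uIcc a b, HasDerivAt (fun z : ℝ => ((-(θ.sig * (θ.nu1 - z) ^ 2 / 2) : ℝ) : ℂ))
      (((θ.sig * (θ.nu1 - x) : ℝ) : ℂ)) x := by
    intro x _
    have h1 : HasDerivAt (fun z : ℝ => -(θ.sig * (θ.nu1 - z) ^ 2 / 2)) (θ.sig * (θ.nu1 - x)) x := by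
      have := (((((hasDerivAt_id x).const_sub θ.nu1).pow 2).const_mul θ.sig).div_const 2).neg
      exact this.congr_deriv (by norm_num [id]; try ring)
    simpa using h1.ofReal_comp
  rw [intervalIntegral.integral_congr (g := fun z => ((θ.sig * (θ.nu1 - z) : ℝ) : ℂ)) (fun t ht => ?_),
    intervalIntegral.integral_eq_sub_of_hasDerivAt hF (Continuous.intervalIntegrable (by fun_prop) _ _)]
  · push_cast; ring
  · rcases le_total a b with hab | hab
    · rw [uIcc_of_le hab] at ht; exact tentT_upper (ha.trans ht.1) (ht.2.trans hb')
    · rw [uIcc_of_ge hab] at ht; exact tentT_upper (hb.trans ht.1) (ht.2.trans ha')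

/-- the tail integral ABOVE the tent: `∫_y^1 f_θ = 0` for `ν₁ ≤ y` (`ν₁ ≤ 1`). [cite: Zhang2022LandauSiegel, (2.28) p.10] -/
theorem integral_tentT_tail_above (h : θ.nu2 < θ.nu1) (h1 : θ.nu1 ≤ 1) {y : ℝ} (hy : θ.nu1 ≤ y) :
    ∫ t in y..1, tentT θ t = 0 :=
  integral_tentT_of_hi_le h hy h1

/-- the tail integral on the falling edge: `∫_y^1 f_θ = σ(ν₁−y)²/2`. [cite: Zhang2022LandauSiegel, (2.28) p.10] -/
theorem integral_tentT_tail_upper (h : θ.nu2 < θ.nu1) (h1 : θ.nu1 ≤ 1) {y : ℝ} (hy : θ.mid1 ≤ y)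
    (hy' : y ≤ θ.nu1) : ∫ t in y..1, tentT θ t = ((θ.sig * (θ.nu1 - y) ^ 2 / 2 : ℝ) : ℂ) := by
  have hm := θ.nu1_eq; have hp := θ.hw_pos h
  rw [← intervalIntegral.integral_add_adjacent_intervals (intervalIntegrable_tentT θ y θ.nu1)
      (intervalIntegrable_tentT θ θ.nu1 1), integral_tentT_upper hy hy' (by linarith) le_rfl,
    integral_tentT_tail_above h h1 le_rfl]
  push_cast; ring

/-- the tail integral on the rising edge: `∫_y^1 f_θ = h − σ(y−ν₂)²/2`. [cite: Zhang2022LandauSiegel, (2.28) p.10] -/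
theorem integral_tentT_tail_lower (h : θ.nu2 < θ.nu1) (h1 : θ.nu1 ≤ 1) {y : ℝ} (hy : θ.nu2 ≤ y)
    (hy' : y ≤ θ.mid1) : ∫ t in y..1, tentT θ t = ((θ.hw - θ.sig * (y - θ.nu2) ^ 2 / 2 : ℝ) : ℂ) := by
  have hm := θ.mid1_eq; have hn := θ.nu1_eq; have hp := θ.hw_pos h; have hs := θ.sig_mul_hw h
  have hsC : (θ.sig : ℂ) * θ.hw = 1 := by exact_mod_cast hs
  rw [← intervalIntegral.integral_add_adjacent_intervals (intervalIntegrable_tentT θ y θ.mid1)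
      (intervalIntegrable_tentT θ θ.mid1 1), integral_tentT_lower hy hy' (by linarith) le_rfl,
    integral_tentT_tail_upper h h1 le_rfl (by linarith), hn, hm]
  push_cast
  linear_combination (θ.hw : ℂ) * hsC

/-- the tail integral BELOW the tent: `∫_y^1 f_θ = h` (the tent's area) for `y ≤ ν₂`.
[cite: Zhang2022LandauSiegel, (2.28) p.10] -/
theorem integral_tentT_tail_below (h : θ.nu2 < θ.nu1) (h1 : θ.nu1 ≤ 1) {y : ℝ} (hy : y ≤ θ.nu2) :
    ∫ t in y..1, tentT θ t = ((θ.hw : ℝ) : ℂ) := by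
  have hm := θ.mid1_eq; have hp := θ.hw_pos h
  rw [← intervalIntegral.integral_add_adjacent_intervals (intervalIntegrable_tentT θ y θ.nu2)
      (intervalIntegrable_tentT θ θ.nu2 1), integral_tentT_of_le_lo h hy le_rfl,
    integral_tentT_tail_lower h h1 le_rfl (by linarith)]
  push_cast; ring

/-- `∫₀¹ f_θ = h` when the tent sits inside `[0,1]`. [cite: Zhang2022LandauSiegel, (2.28) p.10] -/
theorem integral_tentT_unit (h : θ.nu2 < θ.nu1) (h0 : 0 ≤ θ.nu2) (h1 : θ.nu1 ≤ 1) :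
    ∫ t in (0:ℝ)..1, tentT θ t = ((θ.hw : ℝ) : ℂ) :=
  integral_tentT_tail_below h h1 h0

/-! ### The dipole-rule functionals of the tent (formula I; Lemmas 10.1 / 10.2 at the main values) -/

/-- `m`-side of the dipole rule on the rising edge: `f′ + iπj f = σ(1 + iπj(y − ν₂))` — (10.3)'s
`−1 − β_j log(y/P^{0.5})` up to the factor `−σ`. [cite: Zhang2022LandauSiegel, Lemma 10.1 (10.3) p.53] -/
theorem tentDipole_lower {y : ℝ} (hy : θ.nu2 ≤ y) (hy' : y < θ.mid1) (j : ℂ) :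
    tentT' θ y + I * π * j * tentT θ y = (θ.sig : ℂ) * (1 + I * π * j * ((y : ℂ) - θ.nu2)) := by
  rw [tentT'_lower hy hy', tentT_lower hy hy'.le]; push_cast; ring

/-- `m`-side on the falling edge: `f′ + iπj f = −σ(1 − iπj(ν₁ − y))` — (10.4)'s `1 − β_j log(P^{0.504}/y)`.
[cite: Zhang2022LandauSiegel, Lemma 10.1 (10.4) p.53] -/
theorem tentDipole_upper (h : θ.nu2 < θ.nu1) {y : ℝ} (hy : θ.mid1 ≤ y) (hy' : y < θ.nu1) (j : ℂ) :
    tentT' θ y + I * π * j * tentT θ y = -(θ.sig : ℂ) * (1 - I * π * j * ((θ.nu1 : ℂ) - y)) := by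
  rw [tentT'_upper h hy hy', tentT_upper hy hy'.le]; push_cast; ring

/-- **`n`-side (tail functional) on the rising edge = Lemma 10.2 (10.9)**:
`conj(f′ + iπS_j f + π²N_j ∫_y^1 f) = −σ(−1 + 𝔶𝔶₁ⱼ(y))` for `ν₂ ≤ y < mid₁` (the identity
`(ν₁−y)² − 2(mid₁−y)² = 2h² − (y−ν₂)²`). [cite: Zhang2022LandauSiegel, Lemma 10.2 (10.9) p.54] -/
theorem tentTail_lower (h : θ.nu2 < θ.nu1) (h1 : θ.nu1 ≤ 1) {y : ℝ} (hy : θ.nu2 ≤ y) (hy' : y < θ.mid1)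
    (j : ℕ) :
    conj (tentT' θ y + I * π * (bS j : ℂ) * tentT θ y + π ^ 2 * (bN j : ℂ) * ∫ t in y..1, tentT θ t)
      = -(θ.sig : ℂ) * (-1 + yy1T θ j y) := by
  have hm := θ.mid1_eq; have hn := θ.nu1_eq; have hs := θ.sig_mul_hw h
  have hsC : (θ.sig : ℂ) * θ.hw = 1 := by exact_mod_cast hs
  rw [tentT'_lower hy hy', tentT_lower hy hy'.le, integral_tentT_tail_lower h h1 hy hy'.le]
  unfold yy1T
  simp only [map_add, map_mul, Complex.conj_ofReal, Complex.conj_I, map_pow]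
  rw [hn, hm]; push_cast
  linear_combination (-(π : ℂ) ^ 2 * (bN j : ℂ) * θ.hw) * hsC

/-- **`n`-side on the falling edge = Lemma 10.2 (10.10)**: `conj(…) = −σ(1 + 𝔶𝔶₂ⱼ(y))` for
`mid₁ ≤ y < ν₁`. [cite: Zhang2022LandauSiegel, Lemma 10.2 (10.10) p.54] -/
theorem tentTail_upper (h : θ.nu2 < θ.nu1) (h1 : θ.nu1 ≤ 1) {y : ℝ} (hy : θ.mid1 ≤ y) (hy' : y < θ.nu1)
    (j : ℕ) :
    conj (tentT' θ y + I * π * (bS j : ℂ) * tentT θ y + π ^ 2 * (bN j : ℂ) * ∫ t in y..1, tentT θ t)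
      = -(θ.sig : ℂ) * (1 + yy2T θ j y) := by
  rw [tentT'_upper h hy hy', tentT_upper hy hy'.le, integral_tentT_tail_upper h h1 hy hy'.le]
  unfold yy2T
  simp only [map_add, map_mul, Complex.conj_ofReal, Complex.conj_I, map_pow, map_neg]
  push_cast; ring

/-- `n`-side BELOW the tent = Lemma 10.2 (10.8): `conj(…) = π²N_j h` (`= −β_{j+1}β_{j+2}(log P)²·h` at the
main values) for `y < ν₂`. [cite: Zhang2022LandauSiegel, Lemma 10.2 (10.8) p.54] -/
theorem tentTail_below (h : θ.nu2 < θ.nu1) (h1 : θ.nu1 ≤ 1) {y : ℝ} (hy : y < θ.nu2) (j : ℕ) :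
    conj (tentT' θ y + I * π * (bS j : ℂ) * tentT θ y + π ^ 2 * (bN j : ℂ) * ∫ t in y..1, tentT θ t)
      = ((π ^ 2 * bN j * θ.hw : ℝ) : ℂ) := by
  rw [tentT'_of_lt_lo hy, tentT_of_le_lo h hy.le, integral_tentT_tail_below h h1 hy.le]
  simp only [map_mul, Complex.conj_ofReal, map_pow, mul_zero, zero_add]
  push_cast; ring

/-- `n`-side ABOVE the tent: `conj(…) = 0` for `ν₁ ≤ y`. [cite: Zhang2022LandauSiegel, Lemma 10.2 p.54] -/
theorem tentTail_above (h : θ.nu2 < θ.nu1) (h1 : θ.nu1 ≤ 1) {y : ℝ} (hy : θ.nu1 ≤ y) (j : ℕ) :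
    conj (tentT' θ y + I * π * (bS j : ℂ) * tentT θ y + π ^ 2 * (bN j : ℂ) * ∫ t in y..1, tentT θ t)
      = 0 := by
  rw [tentT'_of_hi_le h hy, tentT_of_hi_le h hy, integral_tentT_tail_above h h1 hy]
  simp

end Repair

end Literature.NumberTheory.LFunctions.Zhang2022
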